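import Literature.NumberTheory.DiophantineApproximation.PolylogTwoPointHermitePadeRational
import Literature.NumberTheory.DiophantineApproximation.DilogHermitePadeArithmetic
import HarnessLib

/-!
# Parity Hermite–Padé forms at rational points `y = a/b` — integrality and size of the coefficients

Topic `Literature/NumberTheory/DiophantineApproximation`. For partial-fraction data `c` of the
weight-`w` PARITY kernel (`ParityPade.kernelH`; the parity reduction of David–Hirata-Kohno–Kawashima
2020, Thm 2.1, now at a rational point `y = a/b`) with `d_n^{w−1−o} c_{o,p} ∈ ℤ`
(`BallRivoal.IsInt w d_n c`, `d_n = lcm(1..n) = Nat.lcmUpto n`), the coefficients of the form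
`a^{n/2} 2^w Λ^{(w)}_n(a/b) = ∑_{o<w} A_o Li_{o+1}(a/b) + ∑_{o<w} B_o Θ_{o+1}(a/b) + C`
(`ParityPade.coefLiQ`, `ParityPade.coefThQ`, `ParityPade.constHQ` of
`PolylogTwoPointHermitePadeRational.lean`) become integers after multiplication by `d_n^w`
(`isInt_lcmUpto_pow_mul_coefLiQ`, `isInt_lcmUpto_pow_mul_coefThQ`, `isInt_lcmUpto_pow_mul_constHQ`:
the finite remainders have the denominators `b^{k+1} (k+1)^{o+1}`, `k + 1 ≤ p/2 ≤ n`, at the odd pole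
indices `p` and `b^{k+1} (2k+1)^{o+1}`, `2k + 1 ≤ p − 1 ≤ n`, at the even ones; `(k+1)^{o+1}`,
`(2k+1)^{o+1}` divide `d_n^{o+1}` and `b^{k+1}` divides the factor `b^{p/2}`), and
`|A_o|, |B_o| ≤ (∑|c|) · 2^w · b^{n/2}` for `1 ≤ a ≤ b` (`abs_coefLiQ_le`, `abs_coefThQ_le`; through
`b^{p/2} a^{n/2 − p/2} ≤ b^{n/2}`, natural divisions). This is the rational-point version of
`PolylogTwoPointHermitePadeForms.lean` (the case `a = 1`, `b = M`), with the same proofs.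
Everything is PROVED; no definitions, no named facts.

References: S. David, N. Hirata-Kohno, M. Kawashima, *Can polylogarithms at algebraic points be linearly
independent?*, Moscow J. Comb. Number Th. 9 (2020) 389–406, Thm 2.1 [DavidHirataKohnoKawashima2020];
T. Rivoal, C. R. Acad. Sci. Paris 331 (2000), §2 Lemme 5 (the integrality mechanism) [Rivoal2000];
E. M. Nikišin, Mat. Sb. 109 (1979).
-/

open Finset

namespace Literature.NumberTheory.DiophantineApproximation

namespace ParityPade

open Literature.NumberTheory.Transcendental

/-- **Integrality of the `Li`-coefficients at `a/b`**: `d_n^w · A_o ∈ ℤ` for `o < w`, from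
`d_n^{w−1−o} c_{o,p} ∈ ℤ` (the other factors `2^{w−1−o} b^{p/2} a^{n/2−p/2}` are naturals).
[cite: Rivoal2000, §2 Lemme 5] -/
theorem isInt_lcmUpto_pow_mul_coefLiQ {w n : ℕ} {c : ℕ → ℕ → ℚ}
    (hc : BallRivoal.IsInt w (Nat.lcmUpto n) c) (b a : ℕ) {o : ℕ} (ho : o < w) :
    ∃ z : ℤ, ((Nat.lcmUpto n : ℚ) ^ w) * coefLiQ n w c b a o = z := by
  -- each summand is an integer
  have hterm : ∀ p ∈ range (n + 1), ∃ z : ℤ, ((Nat.lcmUpto n : ℚ) ^ w) *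
      (if Odd p then c o p * 2 ^ (w - 1 - o) * (b : ℚ) ^ (p / 2) * (a : ℚ) ^ (n / 2 - p / 2)
        else 0) = z := by
    intro p _
    split_ifs with hp
    · obtain ⟨z, hz⟩ := hc o p
      refine ⟨z * (Nat.lcmUpto n : ℤ) ^ (o + 1) * 2 ^ (w - 1 - o) * (b : ℤ) ^ (p / 2) *
        (a : ℤ) ^ (n / 2 - p / 2), ?_⟩
      have hdw : (Nat.lcmUpto n : ℚ) ^ w =
          (Nat.lcmUpto n : ℚ) ^ (w - 1 - o) * (Nat.lcmUpto n : ℚ) ^ (o + 1) := by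
        rw [← pow_add]; congr 1; omega
      rw [hdw]
      push_cast
      rw [← hz]
      ring
    · exact ⟨0, by simp⟩
  choose! z hz using hterm
  refine ⟨∑ p ∈ range (n + 1), z p, ?_⟩
  rw [coefLiQ, mul_sum, Int.cast_sum]
  exact sum_congr rfl fun p hp => hz p hp

/-- **Integrality of the `Θ`-coefficients at `a/b`**: `d_n^w · B_o ∈ ℤ` for `o < w`, from
`d_n^{w−1−o} c_{o,p} ∈ ℤ` (the other factors `2^w b^{p/2} a^{n/2−p/2}` are naturals).
[cite: Rivoal2000, §2 Lemme 5] -/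
theorem isInt_lcmUpto_pow_mul_coefThQ {w n : ℕ} {c : ℕ → ℕ → ℚ}
    (hc : BallRivoal.IsInt w (Nat.lcmUpto n) c) (b a : ℕ) {o : ℕ} (ho : o < w) :
    ∃ z : ℤ, ((Nat.lcmUpto n : ℚ) ^ w) * coefThQ n w c b a o = z := by
  -- each summand is an integer
  have hterm : ∀ p ∈ range (n + 1), ∃ z : ℤ, ((Nat.lcmUpto n : ℚ) ^ w) *
      (if Even p then c o p * 2 ^ w * (b : ℚ) ^ (p / 2) * (a : ℚ) ^ (n / 2 - p / 2)
        else 0) = z := by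
    intro p _
    split_ifs with hp
    · obtain ⟨z, hz⟩ := hc o p
      refine ⟨z * (Nat.lcmUpto n : ℤ) ^ (o + 1) * 2 ^ w * (b : ℤ) ^ (p / 2) *
        (a : ℤ) ^ (n / 2 - p / 2), ?_⟩
      have hdw : (Nat.lcmUpto n : ℚ) ^ w =
          (Nat.lcmUpto n : ℚ) ^ (w - 1 - o) * (Nat.lcmUpto n : ℚ) ^ (o + 1) := by
        rw [← pow_add]; congr 1; omega
      rw [hdw]
      push_cast
      rw [← hz]
      ring
    · exact ⟨0, by simp⟩
  choose! z hz using hterm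
  refine ⟨∑ p ∈ range (n + 1), z p, ?_⟩
  rw [coefThQ, mul_sum, Int.cast_sum]
  exact sum_congr rfl fun p hp => hz p hp

/-- **Integrality of the constant term at `a/b`**: `d_n^w · C ∈ ℤ` (`b ≥ 1`), from
`d_n^{w−1−o} c_{o,p} ∈ ℤ` and `m^{o+1} ∣ d_n^{o+1}` for the denominators `m = k + 1 ≤ p/2 ≤ n`
(odd `p`) and `m = 2k + 1 ≤ p − 1 ≤ n` (even `p`, `k < p/2`) of the finite remainders, together with
`b^{p/2} a^{k+1}/b^{k+1} = b^{p/2 − (k+1)} a^{k+1}` (`k + 1 ≤ p/2`). [cite: Rivoal2000, §2 Lemme 5] -/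
theorem isInt_lcmUpto_pow_mul_constHQ {w n : ℕ} {c : ℕ → ℕ → ℚ}
    (hc : BallRivoal.IsInt w (Nat.lcmUpto n) c) {b : ℕ} (hb : 1 ≤ b) (a : ℕ) :
    ∃ z : ℤ, ((Nat.lcmUpto n : ℚ) ^ w) * constHQ n w c b a = z := by
  have hb0 : (b : ℚ) ≠ 0 := by exact_mod_cast (show b ≠ 0 by omega)
  -- the elementary summands `c_{o,p} 2^{w-1-o} b^{p/2} a^{n/2-p/2} a^{k+1}/(b^{k+1} (k+1)^{o+1})`
  -- at the odd pole indices become integers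
  have hodd : ∀ o ∈ range w, ∀ p ∈ range (n + 1), ∀ k ∈ range (p / 2),
      ∃ z : ℤ, ((Nat.lcmUpto n : ℚ) ^ w) *
        (c o p * ((2 : ℚ) ^ (w - 1 - o) *
          ((b : ℚ) ^ (p / 2) * (a : ℚ) ^ (n / 2 - p / 2) *
            ((a : ℚ) ^ (k + 1) / ((b : ℚ) ^ (k + 1) * ((k : ℚ) + 1) ^ (o + 1)))))) = z := by
    intro o ho p hp k hk
    rw [mem_range] at ho hp hk
    obtain ⟨z, hz⟩ := hc o p
    obtain ⟨e, he⟩ : (k + 1) ∣ Nat.lcmUpto n :=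
      Int.natCast_dvd_natCast.1 (DilogPade.natCast_dvd_lcmUpto (by omega) (by omega))
    have hk0 : ((k : ℚ) + 1) ≠ 0 := by positivity
    refine ⟨z * (e : ℤ) ^ (o + 1) * 2 ^ (w - 1 - o) * (b : ℤ) ^ (p / 2 - (k + 1)) *
      (a : ℤ) ^ (n / 2 - p / 2) * (a : ℤ) ^ (k + 1), ?_⟩
    have hdw : (Nat.lcmUpto n : ℚ) ^ w =
        (Nat.lcmUpto n : ℚ) ^ (w - 1 - o) * (Nat.lcmUpto n : ℚ) ^ (o + 1) := by
      rw [← pow_add]; congr 1; omega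
    have hd' : (Nat.lcmUpto n : ℚ) ^ (o + 1) = ((k : ℚ) + 1) ^ (o + 1) * (e : ℚ) ^ (o + 1) := by
      rw [← mul_pow]; congr 1; exact_mod_cast he
    have hbp : (b : ℚ) ^ (p / 2) = (b : ℚ) ^ (p / 2 - (k + 1)) * (b : ℚ) ^ (k + 1) := by
      rw [← pow_add]; congr 1; omega
    rw [hdw, hd', hbp]
    push_cast
    rw [← hz]
    field_simp
  -- the elementary summands `c_{o,p} 2^w b^{p/2} a^{n/2-p/2} a^{k+1}/(b^{k+1} (2k+1)^{o+1})` at the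
  -- even pole indices become integers
  have heven : ∀ o ∈ range w, ∀ p ∈ range (n + 1), ∀ k ∈ range (p / 2),
      ∃ z : ℤ, ((Nat.lcmUpto n : ℚ) ^ w) *
        (c o p * ((2 : ℚ) ^ w *
          ((b : ℚ) ^ (p / 2) * (a : ℚ) ^ (n / 2 - p / 2) *
            ((a : ℚ) ^ (k + 1) / ((b : ℚ) ^ (k + 1) * (2 * (k : ℚ) + 1) ^ (o + 1)))))) = z := by
    intro o ho p hp k hk
    rw [mem_range] at ho hp hk
    obtain ⟨z, hz⟩ := hc o p
    obtain ⟨e, he⟩ : (2 * k + 1) ∣ Nat.lcmUpto n :=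
      Int.natCast_dvd_natCast.1 (DilogPade.natCast_dvd_lcmUpto (by omega) (by omega))
    have hk0 : (2 * (k : ℚ) + 1) ≠ 0 := by positivity
    refine ⟨z * (e : ℤ) ^ (o + 1) * 2 ^ w * (b : ℤ) ^ (p / 2 - (k + 1)) *
      (a : ℤ) ^ (n / 2 - p / 2) * (a : ℤ) ^ (k + 1), ?_⟩
    have hdw : (Nat.lcmUpto n : ℚ) ^ w =
        (Nat.lcmUpto n : ℚ) ^ (w - 1 - o) * (Nat.lcmUpto n : ℚ) ^ (o + 1) := by
      rw [← pow_add]; congr 1; omega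
    have hd' : (Nat.lcmUpto n : ℚ) ^ (o + 1) =
        (2 * (k : ℚ) + 1) ^ (o + 1) * (e : ℚ) ^ (o + 1) := by
      rw [← mul_pow]; congr 1; exact_mod_cast he
    have hbp : (b : ℚ) ^ (p / 2) = (b : ℚ) ^ (p / 2 - (k + 1)) * (b : ℚ) ^ (k + 1) := by
      rw [← pow_add]; congr 1; omega
    rw [hdw, hd', hbp]
    push_cast
    rw [← hz]
    field_simp
  -- sum over `k`
  have h1 : ∀ o ∈ range w, ∀ p ∈ range (n + 1), ∃ z : ℤ, ((Nat.lcmUpto n : ℚ) ^ w) *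
      (c o p *
        (if Odd p then
          (2 : ℚ) ^ (w - 1 - o) *
            ∑ k ∈ range (p / 2), (b : ℚ) ^ (p / 2) * (a : ℚ) ^ (n / 2 - p / 2) *
              ((a : ℚ) ^ (k + 1) / ((b : ℚ) ^ (k + 1) * ((k : ℚ) + 1) ^ (o + 1)))
         else
          (2 : ℚ) ^ w *
            ∑ k ∈ range (p / 2), (b : ℚ) ^ (p / 2) * (a : ℚ) ^ (n / 2 - p / 2) *
              ((a : ℚ) ^ (k + 1) / ((b : ℚ) ^ (k + 1) * (2 * (k : ℚ) + 1) ^ (o + 1))))) = z := by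
    intro o ho p hp
    split_ifs with hpo
    · choose! z hz using hodd o ho p hp
      refine ⟨∑ k ∈ range (p / 2), z k, ?_⟩
      rw [mul_sum, mul_sum, mul_sum, Int.cast_sum]
      exact sum_congr rfl fun k hk => hz k hk
    · choose! z hz using heven o ho p hp
      refine ⟨∑ k ∈ range (p / 2), z k, ?_⟩
      rw [mul_sum, mul_sum, mul_sum, Int.cast_sum]
      exact sum_congr rfl fun k hk => hz k hk
  -- sum over `p`
  have h2 : ∀ o ∈ range w, ∃ z : ℤ, ((Nat.lcmUpto n : ℚ) ^ w) *
      (∑ p ∈ range (n + 1), c o p *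
        (if Odd p then
          (2 : ℚ) ^ (w - 1 - o) *
            ∑ k ∈ range (p / 2), (b : ℚ) ^ (p / 2) * (a : ℚ) ^ (n / 2 - p / 2) *
              ((a : ℚ) ^ (k + 1) / ((b : ℚ) ^ (k + 1) * ((k : ℚ) + 1) ^ (o + 1)))
         else
          (2 : ℚ) ^ w *
            ∑ k ∈ range (p / 2), (b : ℚ) ^ (p / 2) * (a : ℚ) ^ (n / 2 - p / 2) *
              ((a : ℚ) ^ (k + 1) / ((b : ℚ) ^ (k + 1) * (2 * (k : ℚ) + 1) ^ (o + 1))))) = z := by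
    intro o ho
    choose! z hz using h1 o ho
    refine ⟨∑ p ∈ range (n + 1), z p, ?_⟩
    rw [mul_sum, Int.cast_sum]
    exact sum_congr rfl fun p hp => hz p hp
  -- sum over `o`
  choose! z hz using h2
  refine ⟨-∑ o ∈ range w, z o, ?_⟩
  rw [constHQ, mul_neg, mul_sum, Int.cast_neg, Int.cast_sum, neg_inj]
  exact sum_congr rfl fun o ho => hz o ho

/-- **Size of the `Li`-coefficients at `a/b`**: `|A_o| ≤ (∑_{o,p} |c_{o,p}|) · 2^w · b^{n/2}` for
`1 ≤ a ≤ b`, `o < w` (`2^{w−1−o} ≤ 2^w`, `b^{p/2} a^{n/2−p/2} ≤ b^{p/2} b^{n/2−p/2} = b^{n/2}` in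
natural division, `p/2 ≤ n/2`). [folklore] -/
theorem abs_coefLiQ_le {w n : ℕ} (c : ℕ → ℕ → ℚ) {b a : ℕ} (ha : 1 ≤ a) (hab : a ≤ b) {o : ℕ}
    (ho : o < w) :
    |coefLiQ n w c b a o| ≤ BallRivoal.l1 n w c * 2 ^ w * (b : ℚ) ^ (n / 2) := by
  have ha0 : (0 : ℚ) < a := by exact_mod_cast ha
  have hab' : (a : ℚ) ≤ b := by exact_mod_cast hab
  calc |coefLiQ n w c b a o|
      ≤ ∑ p ∈ range (n + 1),
          |(if Odd p then c o p * 2 ^ (w - 1 - o) * (b : ℚ) ^ (p / 2) * (a : ℚ) ^ (n / 2 - p / 2)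
            else 0)| :=
        abs_sum_le_sum_abs _ _
    _ ≤ ∑ p ∈ range (n + 1), |c o p| * 2 ^ w * (b : ℚ) ^ (n / 2) := by
        refine sum_le_sum fun p hp => ?_
        have hpn : p / 2 ≤ n / 2 := Nat.div_le_div_right (Nat.lt_succ_iff.1 (mem_range.1 hp))
        have hba : (b : ℚ) ^ (p / 2) * (a : ℚ) ^ (n / 2 - p / 2) ≤ (b : ℚ) ^ (n / 2) :=
          calc (b : ℚ) ^ (p / 2) * (a : ℚ) ^ (n / 2 - p / 2)
              ≤ (b : ℚ) ^ (p / 2) * (b : ℚ) ^ (n / 2 - p / 2) :=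
                mul_le_mul_of_nonneg_left (pow_le_pow_left₀ ha0.le hab' _) (by positivity)
            _ = (b : ℚ) ^ (n / 2) := by rw [← pow_add]; congr 1; omega
        split_ifs with hpo
        · have h2 : (2 : ℚ) ^ (w - 1 - o) ≤ 2 ^ w := pow_le_pow_right₀ one_le_two (by omega)
          rw [abs_mul, abs_mul, abs_mul, abs_of_nonneg (by positivity : (0 : ℚ) ≤ 2 ^ (w - 1 - o)),
            abs_of_nonneg (by positivity : (0 : ℚ) ≤ (b : ℚ) ^ (p / 2)),
            abs_of_nonneg (by positivity : (0 : ℚ) ≤ (a : ℚ) ^ (n / 2 - p / 2))]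
          calc |c o p| * 2 ^ (w - 1 - o) * (b : ℚ) ^ (p / 2) * (a : ℚ) ^ (n / 2 - p / 2)
              = |c o p| * 2 ^ (w - 1 - o) * ((b : ℚ) ^ (p / 2) * (a : ℚ) ^ (n / 2 - p / 2)) := by
                ring
            _ ≤ |c o p| * 2 ^ w * (b : ℚ) ^ (n / 2) :=
                mul_le_mul (mul_le_mul_of_nonneg_left h2 (abs_nonneg _)) hba (by positivity)
                  (by positivity)
        · rw [abs_zero]; positivity
    _ = (∑ p ∈ range (n + 1), |c o p|) * 2 ^ w * (b : ℚ) ^ (n / 2) := by rw [sum_mul, sum_mul]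
    _ ≤ BallRivoal.l1 n w c * 2 ^ w * (b : ℚ) ^ (n / 2) := by
        refine mul_le_mul_of_nonneg_right (mul_le_mul_of_nonneg_right ?_ (by positivity))
          (by positivity)
        rw [BallRivoal.l1]
        calc ∑ p ∈ range (n + 1), |c o p|
            = ∑ p ∈ range (n + 1), ∑ o' ∈ ({o} : Finset ℕ), |c o' p| := by simp
          _ ≤ ∑ p ∈ range (n + 1), ∑ o' ∈ range w, |c o' p| :=
              sum_le_sum fun p _ => sum_le_sum_of_subset_of_nonneg
                (by simpa using ho) fun _ _ _ => abs_nonneg _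

/-- **Size of the `Θ`-coefficients at `a/b`**: `|B_o| ≤ (∑_{o,p} |c_{o,p}|) · 2^w · b^{n/2}` for
`1 ≤ a ≤ b`, `o < w` (`b^{p/2} a^{n/2−p/2} ≤ b^{n/2}` in natural division). [folklore] -/
theorem abs_coefThQ_le {w n : ℕ} (c : ℕ → ℕ → ℚ) {b a : ℕ} (ha : 1 ≤ a) (hab : a ≤ b) {o : ℕ}
    (ho : o < w) :
    |coefThQ n w c b a o| ≤ BallRivoal.l1 n w c * 2 ^ w * (b : ℚ) ^ (n / 2) := by
  have ha0 : (0 : ℚ) < a := by exact_mod_cast ha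
  have hab' : (a : ℚ) ≤ b := by exact_mod_cast hab
  calc |coefThQ n w c b a o|
      ≤ ∑ p ∈ range (n + 1),
          |(if Even p then c o p * 2 ^ w * (b : ℚ) ^ (p / 2) * (a : ℚ) ^ (n / 2 - p / 2)
            else 0)| :=
        abs_sum_le_sum_abs _ _
    _ ≤ ∑ p ∈ range (n + 1), |c o p| * 2 ^ w * (b : ℚ) ^ (n / 2) := by
        refine sum_le_sum fun p hp => ?_
        have hpn : p / 2 ≤ n / 2 := Nat.div_le_div_right (Nat.lt_succ_iff.1 (mem_range.1 hp))
        have hba : (b : ℚ) ^ (p / 2) * (a : ℚ) ^ (n / 2 - p / 2) ≤ (b : ℚ) ^ (n / 2) :=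
          calc (b : ℚ) ^ (p / 2) * (a : ℚ) ^ (n / 2 - p / 2)
              ≤ (b : ℚ) ^ (p / 2) * (b : ℚ) ^ (n / 2 - p / 2) :=
                mul_le_mul_of_nonneg_left (pow_le_pow_left₀ ha0.le hab' _) (by positivity)
            _ = (b : ℚ) ^ (n / 2) := by rw [← pow_add]; congr 1; omega
        split_ifs with hpe
        · rw [abs_mul, abs_mul, abs_mul, abs_of_nonneg (by positivity : (0 : ℚ) ≤ 2 ^ w),
            abs_of_nonneg (by positivity : (0 : ℚ) ≤ (b : ℚ) ^ (p / 2)),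
            abs_of_nonneg (by positivity : (0 : ℚ) ≤ (a : ℚ) ^ (n / 2 - p / 2))]
          calc |c o p| * 2 ^ w * (b : ℚ) ^ (p / 2) * (a : ℚ) ^ (n / 2 - p / 2)
              = |c o p| * 2 ^ w * ((b : ℚ) ^ (p / 2) * (a : ℚ) ^ (n / 2 - p / 2)) := by ring
            _ ≤ |c o p| * 2 ^ w * (b : ℚ) ^ (n / 2) := mul_le_mul_of_nonneg_left hba (by positivity)
        · rw [abs_zero]; positivity
    _ = (∑ p ∈ range (n + 1), |c o p|) * 2 ^ w * (b : ℚ) ^ (n / 2) := by rw [sum_mul, sum_mul]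
    _ ≤ BallRivoal.l1 n w c * 2 ^ w * (b : ℚ) ^ (n / 2) := by
        refine mul_le_mul_of_nonneg_right (mul_le_mul_of_nonneg_right ?_ (by positivity))
          (by positivity)
        rw [BallRivoal.l1]
        calc ∑ p ∈ range (n + 1), |c o p|
            = ∑ p ∈ range (n + 1), ∑ o' ∈ ({o} : Finset ℕ), |c o' p| := by simp
          _ ≤ ∑ p ∈ range (n + 1), ∑ o' ∈ range w, |c o' p| :=
              sum_le_sum fun p _ => sum_le_sum_of_subset_of_nonneg
                (by simpa using ho) fun _ _ _ => abs_nonneg _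

end ParityPade

end Literature.NumberTheory.DiophantineApproximation
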